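import Mathlib
import HarnessLib
import HarnessLib.Audit
import Summits.QuantumAdvantage.Statement
import Literature.Computability.QuantumComplexity.RandomOracleMeasure
import Literature.Computability.Complexity.AvgPRel
import Literature.Computability.Cryptography.ClassBQP
import Literature.Computability.Cryptography.QuantumQuery
import Literature.Computability.Complexity.Promise
import Literature.Computability.Complexity.Oracle
import Literature.Computability.Complexity.ProbabilisticClasses
import Summits.QuantumAdvantage.QuantumAdvantage.Theorems.SosSandwichCornerLiftD
import HarnessLib.Audit.Status.Attr

/-!
Route: SosSandwich

# Route SosSandwich — bounded because positive — the SOS sandwich class K_T ⊇ quantum turns the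
Aaronson–Ambainis bridge hypothesis of the random-oracle gauge into a flat-Gram-matrix inequality

It suffices to show X = PB-AA (PSEUDO-BOUNDED AARONSON–AMBAINIS; realises idea card
pseudo-bounded-influence, K1): there are
constants c, C > 0 such that for every T ≥ 1 and every real polynomial p on {0,1}^N that is
PSEUDO-BOUNDED OF ORDER T — p and 1 − p are
both sums of squares of polynomials of degree ≤ T as functions on the cube (equivalently: p = ‖ΠF‖²
for a degree-T sphere map F, a
FLAT band-limited psd Gram matrix; equivalently: 0 ≤ Ẽ[p] ≤ 1 for every normalised degree-2T
pseudo-expectation) — Var[p] ≥ ε forces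
a variable of influence ≥ C (ε/T)^c. The class K_T contains every acceptance probability of every
T-query quantum algorithm and all
its restrictions (support QueryAcceptPseudoBounded, PseudoBoundedRestrict) and sits strictly inside
"bounded of degree ≤ 2T", so PB-AA
is WEAKER than the Aaronson–Ambainis conjecture (support AAConjImpliesPBAA) yet is exactly what the
random-oracle gauge consumes: with
the transfer TransferPB (route RandomOracleGauge's T_avg, stmt-10749, antecedent weakened to PB-AA),
the shared hypothesis-type
X_ROG = RandomOracleHeurSeparation (rev 1: stated by name over the fact-free `randomOracle` /
`Complexity.AvgPRel`,
definitionally the shared stmt-1131 of RandomOracleGauge and stmt-11701 of SpikesNeedAddresses) and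
the shared lift PL = PromiseLanguageLift (stmt-0250), closes : PB-AA → TransferPB →
X_ROG → PL → QuantumAdvantage (pure logic, certified).
Lean (rev 1, cone repair: cube averages INLINE — `ev f x` = evalBool f x, `avg` = boolAvg, xⁱ =
Function.update x i (!x i);
Iff.rfl with the rev-0 statement over evalBool/boolVariance/influence, planner evidence Equiv.lean):
`∃ (c : ℕ) (C : ℝ), 0 < C ∧ ∀ (N T : ℕ) (p : MvPolynomial (Fin N) ℝ) (ε : ℝ), let ev : MvPolynomial
(Fin N) ℝ → (Fin N → Bool) → ℝ := fun f x => MvPolynomial.eval (fun k => if x k then (1 : ℝ) else 0)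
f; let avg : ((Fin N → Bool) → ℝ) → ℝ := fun g => (∑ x : Fin N → Bool, g x) / (2 : ℝ) ^ N; 1 ≤ T →
(∃ (m : ℕ) (q r : Fin m → MvPolynomial (Fin N) ℝ), (∀ j, (q j).totalDegree ≤ T ∧ (r j).totalDegree ≤
T) ∧ ∀ x : Fin N → Bool, ev p x = ∑ j, ev (q j) x ^ 2 ∧ 1 - ev p x = ∑ j, ev (r j) x ^ 2) → 0 < ε →
ε ≤ (avg fun x => (ev p x - avg (ev p)) ^ 2) → ∃ i : Fin N, C * (ε / T) ^ c ≤ (avg fun x => (ev p x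
- ev p (Function.update x i (!x i))) ^ 2)`

## Assembly
Pure logic, identical to RandomOracleGauge's certified `closes` with AAConj replaced by PB-AA inside
the transfer: were the summit false,
BQP ⊆ BPP (the existential form undone), PromiseLanguageLift gives PromiseBQP ⊆ PromiseBPP',
TransferPB (granted PseudoBoundedAA) gives
the almost-sure collapse BQP^A ⊆ AvgP^A, contradicting RandomOracleHeurSeparation. Sorry-free in the
planner's Sketch.lean (`closes`,
`assembly_holds`; axioms propext/Classical.choice/Quot.sound). Every crux is a hypothesis of
`closes` and is used. Rev 1: the same five-line proof over the restated
items, natively re-certified.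

Rationale: WHY THIS LINE. Every printed attack on the Aaronson–Ambainis conjecture (arXiv:0911.0996 Conj. 6 =
tree `AAConjecture`, the bridge hypothesis AAConj
of route RandomOracleGauge and the target WT of route SpikesNeedAddresses discharges) is NORM-side —
sup-norm (DFKO, O'Donnell–Zhao,
FilmusEtAl arXiv:1404.3396, Lovett–Zhang, arXiv:2402.13952), cb-norm (arXiv:2203.00212),
Fourier-cb-norm (arXiv:2304.06713, whose
Remark 4.3 says norming functionals cannot see lower Fourier levels) — and pays exp(d) for sup-norm
projections. This line keeps the one
property of a quantum acceptance probability that survives forgetting the unitaries, POSITIVITY: p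
and 1 − p are sums of squares of
the degree-≤T amplitude polynomials (Beals et al. arXiv:quant-ph/9802049 Lemma 4.1 + unitarity),
i.e. p ∈ K_T := {SOS-sandwiched of
order T} = {QE(p) ≤ T ∧ QE(1−p) ≤ T} in the sense of Kaniewski–Lee–de Wolf (arXiv:1411.7280 Thm 12:
query complexity in expectation =
sos degree), a convex, SDP-representable, restriction-closed class with Q_T ⊊ K_T ⊊ {bounded, deg ≤
2T} (Ambainis 2003 Boolean f with
Q_E > deg; Grigoriev / arXiv:1601.02311 bounded quadratics of sos-degree ⌊N/2⌋). Imported area: real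
algebraic geometry / SOS
positivity and its conic dual (pseudo-expectations, pseudo-calibration as in arXiv:1604.03084), plus
frame theory (Bessel / operator
Cauchy–Schwarz on the flat Gram matrix): the T = 1 case is a two-line theorem (support
OneQueryFrameAA: flatness at degree 1 ⟹
orthogonal frame ⟹ Var ≤ 3√maxInf, re-derived by this planner: V₁ ≤ 2√(d₀τ) by Bessel Σᵢ M₀ᵢ² ≤ 1,
V₂ ≤ √τ by M² ≼ M), the homogeneous
rung extends Escudero Gutiérrez's Thm 1.6 from the fcb ball to K_T (support HomogeneousPBAA), and a
refutation is ONE biased pseudo-density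
(support PseudoBoundedDual). Why this form is easier: the hypothesis shrinks (K_T instead of all
bounded polynomials — the Grigoriev
polynomials that positivity cannot see and no algorithm produces are gone) while the transfer T_avg
needs nothing more (its greedy only
restricts acceptance polynomials), and both proof and kill become finite-dimensional certificates
about one psd matrix. Credit: card
pseudo-bounded-influence (mechhunt seat 2272-14), graded new-mechanism by the mechanism critic
2026-08-16; no route of the summit uses
SOS positivity (MomentTransport, retired, measured psd-LIFT SIZE of circuit bootstraps — a different
object and question). Honest status
of the S-arrow: it is the random-oracle GAUGE shared verbatim with RandomOracleGauge /
SpikesNeedAddresses (X_ROG hypothesis-type, PL the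
open lift, certified non-relativizing); the route's earned content is the mathematics of PB-AA and
the transfer with the weaker antecedent,
which rewrites barrier clause RandomOracleMethod (b) from "AAConj ∧ P = P^#P" to "PB-AA ∧ PromiseBQP
⊆ PromiseBPP'".

RANKED CRUXES. (Rev 1, cone repair 2026-08-16: the nine vocabulary-bearing items are RESTATED over
fact-free modules — cube
averages inline, `randomOracle` / `Complexity.AvgPRel` by name — each Iff.rfl-equal to its rev-0
form (planner evidence Equiv.lean);
ranks, kinds and words unchanged; X_ROG's new spelling is also Iff.rfl to SpikesNeedAddresses'
stmt-11701.) #2 PseudoBoundedAA (crux) — PB-AA (card K1, polynomial form): pseudo-bounded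
polynomials of order T with Var ≥ ε have a variable of (tree, L²·4) influence ≥ C(ε/T)^c; the card's
sharp prediction is (c, exponent of T) = (2, 2), forced by the one-query mean ((1+m)/2)² and by
Grover+check. [difficulty: open-problem] (why it might fail: K_T ⊋ Q_T (Boolean f with Q_E(f) > deg
f): a flat band-limited Gram matrix with N^T nearly-dependent frame vectors in small dimension may
spread level-2T mass thinly in a way no unitary chain allows; then retreat to K_T ∩
disjoint-orthogonality or to Q_T.) [arXiv:0911.0996, arXiv:2304.06713, arXiv:1411.7280,
arXiv:2203.00212, arXiv:2402.13952, arXiv:2608.04411]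
#3 TransferPB (crux) — the promise transfer T_avg of route RandomOracleGauge
(stmt-QuantumAdvantage-10749: Aaronson–Ambainis Thm 7(iii)/23 with P = P^#P replaced by PromiseBQP ⊆
PromiseBPP') with its influence antecedent weakened from AAConj to PB-AA: granted PB-AA, if
PromiseBQP ⊆ PromiseBPP' then BQP^A ⊆ AvgP^A for almost every random oracle A. Same proof plan
(greedy of AA Thm 21 with the four counting steps made PromiseBQP estimations under a 4T-wise
independent hash, BBBV-heavy prefix descent), observing that the influence hypothesis is only ever
applied to RESTRICTIONS OF ACCEPTANCE POLYNOMIALS of T-query oracle algorithms, which are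
pseudo-bounded of order T (QueryAcceptPseudoBounded + PseudoBoundedRestrict); a proof of 10749 with
that discipline proves this item verbatim. [deps: PseudoBoundedAA, QueryAcceptPseudoBounded,
PseudoBoundedRestrict] [difficulty: L] (why it might fail: as stmt-10749 (prBPP' coins vs AvgPRel's
deterministic transcript machine; robustness of the greedy to w/2-vs-w gapped Inf tests) PLUS: the
junta-size potential argument must never invoke influences of a surrogate (hashed/truncated)
polynomial outside K_T.) [arXiv:0911.0996, doi:10.1007/978-3-642-32009-5_44, arXiv:quant-ph/9701001,
arXiv:quant-ph/9802049, Literature.Barriers.QuantumAdvantage.RandomOracleMethod]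
#4 RandomOracleHeurSeparation (crux) — X_ROG of route RandomOracleGauge, verbatim (shared item
stmt-QuantumAdvantage-1131; hypothesis-type): the conclusion "BQP^A ⊆ AvgP^A with probability 1" of
Aaronson–Ambainis Thm 7(iii) FAILS — with positive randomOracleMeasure some BQP^A language is
decided by no polynomial-time classical A-machine on a 1 − o(1) fraction of the inputs of each
length. [difficulty: open-problem] (why it might fail: false iff average-case quantum decision
advantage vanishes relative to random oracles (PB-AA ∧ PromiseBQP ⊆ PromiseBPP' refutes it via
TransferPB); plausibly true only through an oracle-free avg-hard witness (factoring on uniform N),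
for which S needs no gauge.) [arXiv:0911.0996, arXiv:cs/9811023, arXiv:2204.02063,
Literature.Barriers.QuantumAdvantage.RandomOracleMethod,
Literature.Barriers.QuantumAdvantage.SeparationPrerequisites]
#5 PromiseLanguageLift (crux) — PL, verbatim the shared lift of routes PromiseLift /
RandomOracleGauge / SpikesNeedAddresses / WhiteBoxWalk (item stmt-QuantumAdvantage-0250): BQP ⊆ BPP
→ PromiseBQP ⊆ PromiseBPP'. [difficulty: open-problem] (why it might fail: false iff BQP ⊆ BPP while
PromiseBQP ⊄ PromiseBPP'; certified NON-relativizing (PromiseLiftRelativization.holds: BQP^A ⊆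
BPP^A, PromiseBQP^A ⊄ PromiseBPP'^A); classical analogue BPP=P ⇒ prBPP=prP open (Goldreich 2011).)
[doi:10.1007/978-3-642-22670-0_20, doi:10.4086/toc.2013.v009a004, arXiv:cs/9811023,
Literature.Barriers.QuantumAdvantage.PromiseLiftRelativization,
Literature.Barriers.QuantumAdvantage.TotalFunctionSpeedupLimit]
#9 OneQueryFrameAA (support) — the T = 1 theorem (card P1, re-derived here): if p and 1 − p are sums
of squares of affine functions on the cube then 4·Var[p]² ≤ 9·maxᵢ Infᵢ[p] (tree influence = 4 × L²
influence; proof: flatness ⟹ orthogonal frame u₀,…,u_N, M = compression of Π, V₁ ≤ 2√(d₀τ) by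
Bessel, V₂ ≤ √τ by M² ≼ M, Var ≤ 3√τ). Extremal ratio 1/36 (mean example), observed max over 1500
random frames 0.027. [difficulty: provable-now] [arXiv:2304.06713, doi:10.1017/CBO9781139814782]
#9 HomogeneousPBAA (support) — homogeneous rung (Escudero Gutiérrez arXiv:2304.06713 Thm 1.6 / Cor
1.7, extended from the fcb ball ⊇ Q_T to K_T): if p is pseudo-bounded of order T and its centred
part lies on Fourier level 2T only (Laplacian eigen-equation Σᵢ(p − p∘flipᵢ) = 4T(p − E p)), then
maxᵢ Infᵢ ≥ C·Var² with C absolute (degree-free). First open rung beyond T = 1; foreseen first child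
of a split of PseudoBoundedAA. [difficulty: L] [arXiv:2304.06713, arXiv:2203.00212]
#9 QueryAcceptPseudoBounded (support) — Q_T ⊆ K_T (card P2): for every T-query quantum algorithm Q
(tree QQueryAlg, XOR-oracle model) there are real polynomials qⱼ, rⱼ of total degree ≤ T with
acceptProb = Σ qⱼ² and 1 − acceptProb = Σ rⱼ² on the cube (real/imaginary parts of the accepted
resp. rejected amplitude polynomials, Beals et al. Lemma 4.1, plus unitarity ‖final state‖ = 1).
[difficulty: M] [arXiv:quant-ph/9802049, arXiv:1411.7280]
#9 PseudoBoundedRestrict (support) — K_T is closed under restriction: substituting a Boolean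
constant for one variable (MvPolynomial.bind₁, the variable kept as a dummy) preserves
pseudo-boundedness of order T (substitute into the qⱼ, rⱼ; degrees do not increase). This is the
only closure property the greedy of TransferPB uses. [difficulty: provable-now] [arXiv:0911.0996,
arXiv:1411.7280]
#9 PseudoBoundedDual (support) — conic duality on the finite cube (card K3's tool, stated as a
theorem): p is pseudo-bounded of order T iff every linear functional Ẽ on real functions of the cube
with Ẽ[1] = 1 and Ẽ[q²] ≥ 0 for all q of total degree ≤ T satisfies 0 ≤ Ẽ[p] ≤ 1 (closedness of the
finite-dimensional SOS cone + bipolar theorem; the zero-mass case is removed by mixing with the true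
expectation). Gives refuters of K1 a finite certificate: one biased pseudo-density. [difficulty: M]
[doi:10.1007/978-0-387-09686-5_7, arXiv:1604.03084, arXiv:1411.7280]
#9 AAConjImpliesPBAA (support) — calibration: the Aaronson–Ambainis conjecture (the verbatim body of
RandomOracleGauge.AAConj = Literature AAConjecture, Iff.rfl checked in Sketch.lean) implies PB-AA —
a pseudo-bounded p of order T has a multilinear representative of total degree ≤ 2T with values in
[0,1], the same variance and influences, so AA at d = 2T gives C(ε/2T)^c. Places PB-AA strictly
below the bridge hypothesis of RandomOracleGauge and below WT ∧ FHKLTotalL1 of SpikesNeedAddresses.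
[difficulty: provable-now] [arXiv:0911.0996, doi:10.1017/CBO9781139814782]

TWO-LAYER PLAN. PseudoBoundedAA ⇐ HomogeneousPBAA → LevelDescent → PseudoBoundedAA, where
LevelDescent ("the general case reduces to the homogeneous top
level with poly(T) loss", the K_T form of Escudero Gutiérrez's Question 4.5 / card K2's cross-level
flatness equations) is typed only
after the homogeneous rung moves; alternative child chain K_T ∩ disjoint-orthogonality
(⟨F̂(S),F̂(S′)⟩ = 0 for disjoint top-level S, S′,
valid for genuine algorithms) if a K_T counterexample appears. TransferPB ⇐ (machine half: greedy in
prBPP' given the influence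
hypothesis on restricted acceptance polynomials) → (probabilistic half:
Literature.Barriers.QuantumAdvantage.ae_BQPRel_subset_AvgPRel_of_apxMachines,
reusable verbatim) → TransferPB, shared with RandomOracleGauge's 10749. The transitive two-sided
test (TransitiveVariance of
SpikesNeedAddresses restricted to K_T, with card steer-the-shift-transitive-variance as its engine)
is a later child, not filed now.

KILL CRITERIA. A pseudo-bounded family (in particular a 2-query family) with Var ≥ const and maxInf
→ 0 as N → ∞ refutes PseudoBoundedAA outright —
close `refuted:PseudoBoundedAA`; if the witness is a genuine quantum algorithm it also refutes
AAConj for quantum polynomials (kills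
RandomOracleGauge's bridge, SpikesNeedAddresses' WT via WTGivesAA, and the hypothesis of barrier
clause RandomOracleMethod (b)); if it
lies in K_T ∖ Q_T, pivot once to K_T ∩ disjoint-orthogonality (new crux) — a second kill closes the
route. A refutation of
HomogeneousPBAA alone demotes the line to "T = 1 only" (close exhausted). PromiseLanguageLift
refuted (BQP ⊆ BPP ∧ PromiseBQP ⊄
PromiseBPP') moots every gauge route including this one. AAConjecture proved in print makes
PseudoBoundedAA a corollary: keep
TransferPB, close superseded by RandomOracleGauge. RandomOracleHeurSeparation is hypothesis-type and
never staffed for proof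
(SeparationPrerequisites: it forces PP ⊄ BPP).

NOT DECOMPOSED YET. The sharp exponents (maxInf ≥ c·Var²/T²: the card's PB-AA_T; both 2's are forced
by the one-query mean and by Grover+check) — filed
only as the prediction in Numbers, not as an item; the relaxed top-level matrix inequality TOP₂
(card K2) over (G, A) with top-flatness
only — untested against the relaxed class, deliberately not typed; K_1 = Q_1 (degree-1 flatness ⟺
orthogonal frame, needs a Naimark
realisation lemma); the Boolean corner f = f² ∈ K_deg (known with exponents Var/deg³ by OSSS +
Midrijanis); any unrelativized use of X_ROG.

CHEAPEST FALSIFIER. RUN by the card's seat (kit j004207/j004208/j004209/j004226, (1+1)-ES over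
Haar-seeded 1-,2-,3-query algorithms, N = 4…12, all 2^N
inputs exact): minimised maxInf_L²/Var² = 3.6–3.9 / 1.8–2.2 / 1.6–2.5, flat in N — the Var²-form
survives; the naive frame-bound route to
T ≥ 2 was refuted before filing (κ_top grows at T = 3). RUN here (exp/t1_check.py, 1500 random
orthogonal frames, N ≤ 6, pure Python,
seconds): max 4Var²/(9·maxInf_tree) = 0.027 against the proved ≤ 1 and the extremal 1/36. Still
cheapest and fatal: ANY explicit
pseudo-bounded family of order 2 (a Boolean degree-2 function, a 2-query algorithm, or an SDP-found
flat Gram matrix at N ≤ 12) with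
Var ≥ const and maxInf·N bounded — one SDP per N.

NUMBERS. Prediction (card): maxInf_L² ≥ c·Var²/T² on K_T, constants N-free; one query:
maxInf_L²/Var² → 4 (mean example); T Grover iterations +
check: Var ≍ 1, maxInf ≍ 1/T². Known: AA for all bounded p with Inf ≥ ε⁵/2^{O(d)} (DFKO = AA14 Thm
9); homogeneous fcb ≤ 1: maxInf ≥
Var² (arXiv:2304.06713 Thm 1.6); cb block-multilinear: (Var/d)² (arXiv:2203.00212, 2304.06713 Thm
1.8); Boolean corner Var/O(deg³)
(OSSS + Midrijanis). T = 1 here: Var² ≤ 9·maxInf_L². Items at open: 11 (4 cruxes, 6 supports, 1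
assembly).

DEFINITION REQUESTS. CONE (rev 1, route-repair 2026-08-16): the route file now imports only
QuantumComplexity.RandomOracleMeasure,
Complexity.AvgPRel (both fact-free, landed by defn-RandomOracleVocabulary),
Cryptography.QuantumQuery (its 7 Prop facts all `_holds`-discharged in
ExactQuantumQuery.lean / PolynomialMethod.lean) and Cryptography.ClassBQP, Complexity.Promise,
Complexity.Oracle, Complexity.ProbabilisticClasses
(inside the sub Statement's own import closure): the 3 route-attributable unproved facts of rev 0
(yamakawa_zhandry via OracleSeparations.lean =
home of randomOracleMeasure; the open conjectures AAConjecture / QuantumQuerySimulable via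
AaronsonAmbainis.lean = home of
boolAvg/evalBool/flipBit/boolVariance/influence; both re-imported by
Barriers/QuantumAdvantage/RandomOracleMethod.lean = home of the AvgPRel
synonym) are gone; no item ever used them as hypotheses. needs-fact: none. What is left (7:
BQPEqBPP, BQPQTM_eq_BQP, BQPQTMWith_adhAmplitudes,
FactInP, lenstra_pomerance, NFSConjecture, FactoringInFP) rides on the operator-owned
Statement.lean's docstring-only imports and is shared by
every route of the summit. PRICE: cube averages are written inline (`let ev := f x ↦
MvPolynomial.eval (0/1-coding of x) f`, `let avg := g ↦
(Σₓ g x)/2^N`; defeq, Iff.rfl: Equiv.lean attached as item evidence). DEFINITION ITEMS: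
`PseudoBounded (T : ℕ) (p : MvPolynomial (Fin N) ℝ) :
Prop` (p and 1 − p are sums of squares of totalDegree-≤T polynomials as functions on the cube; item
defn-PseudoBounded, filed at open) MUST land
in a FACT-FREE module (e.g. Literature/Computability/QuantumComplexity/PseudoBounded.lean importing
Mathlib only, evaluation written as
`MvPolynomial.eval (fun k => if x k then 1 else 0)` or via BooleanInfluence.lean once
defn-BooleanInfluence lands) — NOT "next to AAConjecture in
AaronsonAmbainis.lean" as the rev-0 request said, or the by-name restatement would re-import both
open conjectures into the module cone;
defn-BooleanInfluence (hoist of the cube vocabulary, BLOCKED: needs an operator atomic apply) is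
wanted by this route too — afterwards an
imports-only edit re-states the items BY NAME. PROVER NOTE (module cone): the gate links a proved
item into this file by `import
…Theorems.<Name>` + `theorem <Decl>_holds`, so a Theorems file's imports join the route's module
cone. For the analytic items
(PseudoBoundedAA, OneQueryFrameAA, HomogeneousPBAA, PseudoBoundedRestrict, PseudoBoundedDual,
AAConjImpliesPBAA, QueryAcceptPseudoBounded)
import Mathlib, PolynomialMethod.lean / MultilinearExtension.lean (conjecture-free: Beals et al.
amplitude polynomials,
`QQueryAlg.acceptProb_le_one_holds`) and, if needed, InfluenceBounds.lean (`change`/`show` the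
inline `let`s into boolVariance/influence/boolAvg
first — they are defeq; it becomes conjecture-free when the hoist rewires it) — but do NOT import
AaronsonAmbainis.lean,
DFKOInfluenceBound.lean, OracleSeparations.lean or Barriers/QuantumAdvantage/RandomOracleMethod.lean
directly. TransferPB needs the
random-oracle machinery anyway (RandomOracleCylinders/Independence, RandomOracleMethodProofs:
`ae_BQPRel_subset_AvgPRel_of_apxMachines`);
state its helper lemmas over `randomOracle` / `Complexity.AvgPRel` (the synonyms rewrite by `rfl`).
RandomOracleHeurSeparation is
hypothesis-type and never staffed for proof.

Novelty: Searches (2026-08-16, this seat): `lit search "Aaronson-Ambainis conjecture" --source arxiv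
--year-from 2024` (3: 2402.13952, 2411.14416,
2608.04411 — none SOS-side); `lit citing arxiv:2304.06713` (4: 2411.14416, 2405.10933, 2212.08559,
2304.13703 — none on positivity);
`lit citing arxiv:1411.7280 --source api` (12 works 2015–2023: conical juntas, partition number,
sos-degree of symmetric quadratics
1601.02311 — none on influences/AA); `lit galaxy search "Aaronson-Ambainis conjecture" --star all`
(9 rows: Montanaro 1208.0161 slides,
Defant–Mastyło–Pérez 1706.03670, ECCC TR24-035, Arora et al. quantum depth — none SOS-side); `lit
read arxiv:2603.29256 --grep
sum.of.squares|pseudo|Gram` (completions of partial functions; Conj. 2 restates AA; no SOS); searchd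
hybrid unavailable (rc 75) this
session. The mechanism critic's own searches (card, 2026-08-16: arXiv 16, S2 16, 137 forward
citations of AA14, KLdW citations, galaxy
bm25 30, full-text greps of 2304.06713/1411.7280/1208.0161/2212.08559/2603.29256) found no SOS/psd
entry either. Hub: 190 idea cards and
all 35 open + 13 closed route files read — SOS positivity appears only as psd-LIFT SIZE in the
retired MomentTransport.
Nearest prior art found: arXiv:2304.06713 (Escudero Gutiérrez: Q_T = {deg ≤ 2T, fcb ≤ 1}, Conj. 1.5,
homogeneous Thm 1.6, Rem. 4.3 —
NORM side, norming functionals); arXiv:1411.7280 (Kaniewski–Lee–de Wolf: sos-degree = query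
complexity in expectation, no influences);
arXiv:2203.00212; hub card spikes-need-ad  [refs: 2304.06713, 1411.7280, 2603.29256, 2203.00212, arxiv:2304.06713, arxiv:1411.7280, arxiv:2603.29256]

Barriers (technique_class: sos-positivity, frame-cauchy-schwarz, fourier-analysis): - technique_class: sos-positivity, frame-cauchy-schwarz, fourier-analysis
- Literature.Barriers.QuantumAdvantage.RandomOracleMethod: not evaded but SERVED — TransferPB is its
clause (b) (AA14 Thm 7(iii)) with P = P^#P ↦ PromiseBQP ⊆ PromiseBPP' and AAConj ↦ PB-AA; the route
claims no random-oracle separation itself (X_ROG is a listed hypothesis-type crux, shared with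
RandomOracleGauge).
- Literature.Barriers.QuantumAdvantage.TotalFunctionSpeedupLimit: consistent — the Boolean corner f
= f² ∈ K_deg of PB-AA is the OSSS/Midrijanis "no speedup for total functions" phenomenon; PB-AA is
its most-inputs analogue on the SOS class, not a speedup claim.
- Literature.Barriers.QuantumAdvantage.PromiseLiftRelativization: applies to crux
PromiseLanguageLift (in the cone): the tree proves PL has no relativizing proof (oracle K ⊕ G); this
route adds nothing to PL and inherits PromiseLift's white-box complete-language road — it does not
evade the barrier; the bet is that PL is decided elsewhere (shared item 0250).
- Literature.Barriers.QuantumAdvantage.Relativization: the S-arrow's class-separation content sits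
in the hypothesis-type cruxes X_ROG and PL; PB-AA, TransferPB and all supports are
relativization-agnostic pure mathematics / oracle-uniform simulation theorems — nothing here is a
relativizing proof of S (same for Literature.Barriers.QuantumAdvantage.Algebrization and
Literature.Barriers.QuantumAdvantage.NaturalProofs: no circuit lower bound is argued).
- Literature.Barriers.QuantumA

History (route lifecycle, newest last):
- 2026-08-16T14:08:36Z · rev 1: restated PseudoBoundedAA (stmt-QuantumAdvantage-15070), TransferPB (stmt-QuantumAdvantage-15071), RandomOracleHeurSeparation (stmt-QuantumAdvantage-1131), OneQueryFrameAA (stmt-QuantumAdvantage-15072), HomogeneousPBAA (stmt-QuantumAdvantage-15073), QueryAcceptPseudoBounded (stmt-QuantumAdvantage-15074), PseudoBo (planner-rrepair-QuantumAdvantage-SosSandwich-936371f0-0)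
- 2026-08-31T13:20:00Z · BROKEN — HomogeneousPBAA (stmt-QuantumAdvantage-15241, support) refuted by Summit.QuantumAdvantage.QuantumAdvantage.Theorems.SosSandwich.not_HomogeneousPBAA (prover-leafhand-qadv-sossandwich-3-g0-0)
- 2026-08-31T14:05:20Z · rev 2: restated HomogeneousPBAA (stmt-QuantumAdvantage-15241 refuted) — repair: HomogeneousPBAA (stmt-15241, support, outside the closes cone) refuted-misstated by Theorems.SosSandwich.not_HomogeneousPBAA (p823896: address family, V (operator:999:561507)
- 2026-08-31T14:05:20Z · REPAIRED (restate HomogeneousPBAA) — back to open: repair: HomogeneousPBAA (stmt-15241, support, outside the closes cone) refuted-misstated by Theorems.SosSandwich.not_HomogeneousPBAA (p823896: address family, V (operator:999:561507)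

sub-problem: QuantumAdvantage · status: open · opened planner-plan-novel-QuantumAdvantage-QuantumAdva-e0108269-0 2026-08-16T13:51:39Z · rev 2 · ledger route-QuantumAdvantage-SosSandwich
GENERATED by the gate from the ledger (D-0016/17). Provers cite these decls: `theorem foo : Summit.QuantumAdvantage.QuantumAdvantage.Theses.SosSandwich.<Decl> := …` in Summits/QuantumAdvantage/QuantumAdvantage/Theorems/<Name>.lean.
-/

namespace Summit.QuantumAdvantage.QuantumAdvantage.Theses.SosSandwich

open scoped BigOperators Topology Manifold Classical MeasureTheory ProbabilityTheory Matrix InnerProductSpace ComplexConjugate ContinuousMap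
open Filter Set Function TopologicalSpace MeasureTheory

attribute [summit_statement] _root_.QuantumAdvantage

open Literature.QuantumAdvantage

/-! Retired items kept as plain definitions (history; not obligations of this route): landed proofs / closed glue still name them. -/

/-- retired stmt-QuantumAdvantage-15241 (replaced, gen None) — refuted by Summit.QuantumAdvantage.QuantumAdvantage.Theorems.SosSandwich.not_HomogeneousPBAA. -/
def HomogeneousPBAA : Prop :=
  ∃ C : ℝ, 0 < C ∧ ∀ (N T : ℕ) (p : MvPolynomial (Fin N) ℝ), let ev : MvPolynomial (Fin N) ℝ → (Fin N → Bool) → ℝ := fun f x => MvPolynomial.eval (fun k => if x k then (1 : ℝ) else 0) f; let avg : ((Fin N → Bool) → ℝ) → ℝ := fun g => (∑ x : Fin N → Bool, g x) / (2 : ℝ) ^ N; 1 ≤ T → (∃ (m : ℕ) (q r : Fin m → MvPolynomial (Fin N) ℝ), (∀ j, (q j).totalDegree ≤ T ∧ (r j).totalDegree ≤ T) ∧ ∀ x : Fin N → Bool, ev p x = ∑ j, ev (q j) x ^ 2 ∧ 1 - ev p x = ∑ j, ev (r j) x ^ 2) → (∀ x : Fin N → Bool, ∑ i : Fin N, (ev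 p x - ev p (Function.update x i (!x i))) = 4 * (T : ℝ) * (ev p x - avg (ev p))) → 0 < (avg fun x => (ev p x - avg (ev p)) ^ 2) → ∃ i : Fin N, C * (avg fun x => (ev p x - avg (ev p)) ^ 2) ^ 2 ≤ (avg fun x => (ev p x - ev p (Function.update x i (!x i))) ^ 2)

-- earlier PseudoBoundedAA (stmt-QuantumAdvantage-15070, replaced 2026-08-16T14:08:36Z -> stmt-QuantumAdvantage-15237): retired by None — ∃ (c : ℕ) (C : ℝ), 0 < C ∧ ∀ (N T : ℕ) (p : MvPolynomial (Fin N) ℝ) (ε : ℝ), 1 ≤ T → (∃ (m : ℕ) (q r : Fin m → MvPolynomial (Fin N) ℝ), (∀ j, (q j).totalDegree ≤ T ∧ (r j).totalDegree ≤ T) ∧ ∀ x : Fin N → Bool, Literature.Computability.QuantumComplexity.evalBool p 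
/-- item stmt-QuantumAdvantage-15237 · crux · rank 2 · open · by planner
why it might fail: K_T ⊋ Q_T (Boolean f with Q_E(f) > deg f): a flat band-limited Gram matrix with N^T nearly-dependent frame vectors in small dimension may spread level-2T mass thinly in a way no unitary chain allows; then retreat to K_T ∩ disjoint-orthogonality or to Q_T.
sources: arXiv:0911.0996, arXiv:2304.06713, arXiv:1411.7280, arXiv:2203.00212, arXiv:2402.13952, arXiv:2608.04411
[crux] PB-AA (card K1, polynomial form): pseudo-bounded polynomials of order T with Var ≥ ε have a
variable of (tree, L²·4) influence ≥ C(ε/T)^c; the card's sharp prediction is (c, exponent of T) =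
(2, 2), forced by the one-query mean ((1+m)/2)² and by Grover+check. [difficulty: open-problem] Cone
repair rev 1: cube averages written INLINE over Mathlib (`let ev := f x ↦ MvPolynomial.eval
(0/1-coding of x) f` = evalBool, `let avg := g ↦ (Σₓ g x)/2^N` = boolAvg, xⁱ = Function.update x i
(!x i)) instead of the tree's evalBool/boolVariance/influence — DEFINITIONALLY EQUAL to the rev-0
statement stmt-QuantumAdvantage-15070 (Iff.rfl, planner evidence Equiv.lean), so every tree lemma on
boolVariance/influence/boolAvg applies after `show`/`change`; sole purpose: keep
AaronsonAmbainis.lean (home of the open conjectures AAConjecture/QuantumQuerySimulable) out of the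
route's module cone. -/
@[route_item "route-QuantumAdvantage-SosSandwich", crux (bottleneck := idea) (source := "director FRONTIER l.82, 2026-09-01")]
def PseudoBoundedAA : Prop :=
  ∃ (c : ℕ) (C : ℝ), 0 < C ∧ ∀ (N T : ℕ) (p : MvPolynomial (Fin N) ℝ) (ε : ℝ), let ev : MvPolynomial (Fin N) ℝ → (Fin N → Bool) → ℝ := fun f x => MvPolynomial.eval (fun k => if x k then (1 : ℝ) else 0) f; let avg : ((Fin N → Bool) → ℝ) → ℝ := fun g => (∑ x : Fin N → Bool, g x) / (2 : ℝ) ^ N; 1 ≤ T → (∃ (m : ℕ) (q r : Fin m → MvPolynomial (Fin N) ℝ), (∀ j, (q j).totalDegree ≤ T ∧ (r j).totalDegree ≤ T) ∧ ∀ x : Fin N → Bool, ev p x = ∑ j, ev (q j) x ^ 2 ∧ 1 - ev p x = ∑ j, ev (r j) x ^ 2) → 0 < ε → ε ≤ (avg fun x => (ev p x - avg (ev p)) ^ 2) → ∃ i : Fin N, C * (ε / T) ^ c ≤ (avg fun x => (ev p x - ev p (Function.update x i (!x i))) ^ 2)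

-- earlier TransferPB (stmt-QuantumAdvantage-15071, replaced 2026-08-16T14:08:36Z -> stmt-QuantumAdvantage-15238): retired by None — PseudoBoundedAA → Literature.Computability.Cryptography.PromiseBQP ⊆ Literature.Computability.Complexity.PromiseBPP' → ∀ᵐ A ∂Literature.Computability.QuantumComplexity.randomOracleMeasure, Literature.Computability.Cryptography.BQPRel (A : Language Bool) ⊆ Literature.Bar
/-- item stmt-QuantumAdvantage-15238 · crux · rank 3 · open · by planner
why it might fail: as stmt-10749 (prBPP' coins vs AvgPRel's deterministic transcript machine; robustness of the greedy to w/2-vs-w gapped Inf tests) PLUS: the junta-size potential argument must never invoke influences of a surrogate (hashed/truncated) polynomial outside K_T.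
sources: arXiv:0911.0996, doi:10.1007/978-3-642-32009-5_44, arXiv:quant-ph/9701001, arXiv:quant-ph/9802049, Literature.Barriers.QuantumAdvantage.RandomOracleMethod
[crux] the promise transfer T_avg of route RandomOracleGauge (stmt-QuantumAdvantage-10749:
Aaronson–Ambainis Thm 7(iii)/23 with P = P^#P replaced by PromiseBQP ⊆ PromiseBPP') with its
influence antecedent weakened from AAConj to PB-AA: granted PB-AA, if PromiseBQP ⊆ PromiseBPP' then
BQP^A ⊆ AvgP^A for almost every random oracle A. Same proof plan (greedy of AA Thm 21 with the four
counting steps made PromiseBQP estimations under a 4T-wise independent hash, BBBV-heavy prefix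
descent), observing that the influence hypothesis is only ever applied to RESTRICTIONS OF ACCEPTANCE
POLYNOMIALS of T-query oracle algorithms, which are pseudo-bounded of order T
(QueryAcceptPseudoBounded + PseudoBoundedRestrict); a proof of 10749 with that discipline proves
this item verbatim. [deps: PseudoBoundedAA, QueryAcceptPseudoBounded, PseudoBoundedRestrict]
[difficulty: L] Cone repair rev 1: conclusion stated over the fact-free
`Literature.Computability.QuantumComplexity.randomOracle` (RandomOracleMeasure.lean) and
`Literature.Computability.Complexity.AvgPRel` (Complexity/AvgPRel.lean) instead of the reducible
synonyms randomOracleMeasure (OracleSeparations.lean, home of yamakawa_zhandry) / Barriers.Qua -/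
@[route_item "route-QuantumAdvantage-SosSandwich", crux]
def TransferPB : Prop :=
  PseudoBoundedAA → Literature.Computability.Cryptography.PromiseBQP ⊆ Literature.Computability.Complexity.PromiseBPP' → ∀ᵐ A ∂Literature.Computability.QuantumComplexity.randomOracle, Literature.Computability.Cryptography.BQPRel (A : Language Bool) ⊆ Literature.Computability.Complexity.AvgPRel (Literature.Computability.Complexity.Oracle.ofLanguage (A : Language Bool))

-- earlier RandomOracleHeurSeparation (stmt-QuantumAdvantage-1131, replaced 2026-08-16T14:08:36Z -> stmt-QuantumAdvantage-15239): open — ¬ ∀ᵐ A ∂Literature.Computability.QuantumComplexity.randomOracleMeasure, Literature.Computability.Cryptography.BQPRel (A : Language Bool) ⊆ Literature.Barriers.QuantumAdvantage.AvgPRel (Literature.Computability.Complexity.Oracle.ofLanguage (A : Language Bool))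
/-- item stmt-QuantumAdvantage-15239 · crux · rank 4 · open · by planner
why it might fail: false iff average-case quantum decision advantage vanishes relative to random oracles (PB-AA ∧ PromiseBQP ⊆ PromiseBPP' refutes it via TransferPB); plausibly true only through an oracle-free avg-hard witness (factoring on uniform N), for which S needs no gauge.
sources: arXiv:0911.0996, arXiv:cs/9811023, arXiv:2204.02063, Literature.Barriers.QuantumAdvantage.RandomOracleMethod, Literature.Barriers.QuantumAdvantage.SeparationPrerequisites
[crux] THESIS X of route RandomOracleGauge (hypothesis-type): the conclusion of AA14 Thm 7(iii)
FAILS — the set of oracles A with BQP^A ⊄ AvgP^A (some BQP^A language that no polynomial-time P^A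
transcript machine decides on a 1−o(1) fraction of the inputs of each length; AvgPRel of
RandomOracleMethod.lean) has POSITIVE randomOracleMeasure (equivalently measure 1: the event is a
tail event). This is what 'random oracles separate BQP from classical computation' must mean after
Aaronson–Ambainis (worst-case P^A ≠ BQP^A a.e. is also open, arXiv:0911.0996 p. 5, but only the
average-case form transfers). Under AAConjecture, X ∧ PromiseTransfer ⟹ ¬(PromiseBQP ⊆ PromiseBPP')
= PromiseLift.PlThesis, and with the tree fact aaronsonAmbainis2014_thm7iii, X ⟹ P ≠ P^#P
(P_ne_PSharpP_of_randomOracle_separation, checked in the planner's sketch). WHY IT MIGHT FAIL: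
probably FALSE — AAConj ∧ (PromiseBQP ⊆ PromiseBPP') refutes it by PromiseTransfer (AA: quantum
decision speedups need structure); no candidate language is known (Forrelation of a random pair is
2^{-n/2}-small; Simon/period structure has measure 0; Yamakawa–Zhandry arXiv:2204.02063 is
SEARCH-only, Fourier sampling is SAMPLING-only); gran -/
@[route_item "route-QuantumAdvantage-SosSandwich", crux]
def RandomOracleHeurSeparation : Prop :=
  ¬ ∀ᵐ A ∂Literature.Computability.QuantumComplexity.randomOracle, Literature.Computability.Cryptography.BQPRel (A : Language Bool) ⊆ Literature.Computability.Complexity.AvgPRel (Literature.Computability.Complexity.Oracle.ofLanguage (A : Language Bool))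

/-- item stmt-QuantumAdvantage-0250 · crux · rank 5 · open · by planner
why it might fail: false iff BQP ⊆ BPP while PromiseBQP ⊄ PromiseBPP'; certified NON-relativizing (PromiseLiftRelativization.holds: BQP^A ⊆ BPP^A, PromiseBQP^A ⊄ PromiseBPP'^A); classical analogue BPP=P ⇒ prBPP=prP open (Goldreich 2011).
sources: doi:10.1007/978-3-642-22670-0_20, doi:10.4086/toc.2013.v009a004, arXiv:cs/9811023, Literature.Barriers.QuantumAdvantage.PromiseLiftRelativization, Literature.Barriers.QuantumAdvantage.TotalFunctionSpeedupLimit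
OPEN structural question (analogue of 'P = BPP ⇒ prP = prBPP?', Goldreich2011 §1): does equality of
the language classes force equality of the textbook promise classes? The obstruction: a PromiseBQP
family has no acceptance gap off the promise, so its threshold set is not a BQP language. Most
informative crux of the route: a proof makes every PromiseBQP-completeness result (Jones,
Forrelation) a bona fide reformulation of BQP ≠ BPP; a relativized counterexample would explain why
decision-level quantum advantage evidence is scarce. [Goldreich2006 §1.2; Goldreich2011; Watrous2009
§III.2] -/
@[route_item "route-QuantumAdvantage-SosSandwich", crux]
def PromiseLanguageLift : Prop :=
  Literature.Computability.Cryptography.BQP ⊆ Literature.Computability.Complexity.BPP → Literature.Computability.Cryptography.PromiseBQP ⊆ Literature.Computability.Complexity.PromiseBPP'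

-- earlier OneQueryFrameAA (stmt-QuantumAdvantage-15072, replaced 2026-08-16T14:08:36Z -> stmt-QuantumAdvantage-15240): retired by None — ∀ (N : ℕ) (p : MvPolynomial (Fin N) ℝ), (∃ (m : ℕ) (q r : Fin m → MvPolynomial (Fin N) ℝ), (∀ j, (q j).totalDegree ≤ 1 ∧ (r j).totalDegree ≤ 1) ∧ ∀ x : Fin N → Bool, Literature.Computability.QuantumComplexity.evalBool p x = ∑ j, Literature.Computability.QuantumComp
/-- item stmt-QuantumAdvantage-15240 · support · rank 9 · closed · proved by Summit.QuantumAdvantage.QuantumAdvantage.Theorems.SosSandwich.OneQueryFrameAA_proof @ ef697e0a0b90 (prover) · by planner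
sources: arXiv:2304.06713, doi:10.1017/CBO9781139814782
[support] the T = 1 theorem (card P1, re-derived here): if p and 1 − p are sums of squares of affine
functions on the cube then 4·Var[p]² ≤ 9·maxᵢ Infᵢ[p] (tree influence = 4 × L² influence; proof:
flatness ⟹ orthogonal frame u₀,…,u_N, M = compression of Π, V₁ ≤ 2√(d₀τ) by Bessel, V₂ ≤ √τ by M² ≼
M, Var ≤ 3√τ). Extremal ratio 1/36 (mean example), observed max over 1500 random frames 0.027.
[difficulty: provable-now] Cone repair rev 1: cube averages inline (defeq to the rev-0
stmt-QuantumAdvantage-15072 by Iff.rfl, Equiv.lean). -/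
@[route_item "route-QuantumAdvantage-SosSandwich"]
def OneQueryFrameAA : Prop :=
  ∀ (N : ℕ) (p : MvPolynomial (Fin N) ℝ), let ev : MvPolynomial (Fin N) ℝ → (Fin N → Bool) → ℝ := fun f x => MvPolynomial.eval (fun k => if x k then (1 : ℝ) else 0) f; let avg : ((Fin N → Bool) → ℝ) → ℝ := fun g => (∑ x : Fin N → Bool, g x) / (2 : ℝ) ^ N; (∃ (m : ℕ) (q r : Fin m → MvPolynomial (Fin N) ℝ), (∀ j, (q j).totalDegree ≤ 1 ∧ (r j).totalDegree ≤ 1) ∧ ∀ x : Fin N → Bool, ev p x = ∑ j, ev (q j) x ^ 2 ∧ 1 - ev p x = ∑ j, ev (r j) x ^ 2) → 0 < (avg fun x => (ev p x - avg (ev p)) ^ 2) → ∃ i : Fin N, 4 * (avg fun x => (ev p x - avg (ev p)) ^ 2) ^ 2 ≤ 9 * (avg fun x => (ev p x - ev p (Function.update x i (!x i))) ^ 2)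

-- `OneQueryFrameAA` holds: proved by `Summit.QuantumAdvantage.QuantumAdvantage.Theorems.SosSandwich.OneQueryFrameAA_proof` @ ef697e0a0b90 (its module imports this route file, so no `_holds` link can be stated here).

-- earlier QueryAcceptPseudoBounded (stmt-QuantumAdvantage-15074, replaced 2026-08-16T14:08:36Z -> stmt-QuantumAdvantage-15242): retired by None — ∀ (N : ℕ) (Q : Literature.Computability.Cryptography.QQueryAlg N), ∃ (m : ℕ) (q r : Fin m → MvPolynomial (Fin N) ℝ), (∀ j, (q j).totalDegree ≤ Q.queries ∧ (r j).totalDegree ≤ Q.queries) ∧ ∀ x : Fin N → Bool, Q.acceptProb x = ∑ j, Literature.Computability.Q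
/-- item stmt-QuantumAdvantage-15242 · support · rank 9 · closed · proved by Summit.QuantumAdvantage.QuantumAdvantage.Theorems.SosSandwich.QueryAcceptPseudoBounded_proof @ aeb987cab578 (prover) · by planner
sources: arXiv:quant-ph/9802049, arXiv:1411.7280
[support] Q_T ⊆ K_T (card P2): for every T-query quantum algorithm Q (tree QQueryAlg, XOR-oracle
model) there are real polynomials qⱼ, rⱼ of total degree ≤ T with acceptProb = Σ qⱼ² and 1 −
acceptProb = Σ rⱼ² on the cube (real/imaginary parts of the accepted resp. rejected amplitude
polynomials, Beals et al. Lemma 4.1, plus unitarity ‖final state‖ = 1). [difficulty: M] Cone repair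
rev 1: evaluation on the cube written inline (`ev` = evalBool; defeq to the rev-0
stmt-QuantumAdvantage-15074 by Iff.rfl, Equiv.lean); QQueryAlg/acceptProb/queries by name from
Cryptography/QuantumQuery.lean (conjecture-free; its facts are all `_holds`-discharged). Natural
proof imports: PolynomialMethod.lean (amplitude polynomials), conjecture-free. -/
@[route_item "route-QuantumAdvantage-SosSandwich"]
def QueryAcceptPseudoBounded : Prop :=
  ∀ (N : ℕ) (Q : Literature.Computability.Cryptography.QQueryAlg N), let ev : MvPolynomial (Fin N) ℝ → (Fin N → Bool) → ℝ := fun f x => MvPolynomial.eval (fun k => if x k then (1 : ℝ) else 0) f; ∃ (m : ℕ) (q r : Fin m → MvPolynomial (Fin N) ℝ), (∀ j, (q j).totalDegree ≤ Q.queries ∧ (r j).totalDegree ≤ Q.queries) ∧ ∀ x : Fin N → Bool, Q.acceptProb x = ∑ j, ev (q j) x ^ 2 ∧ 1 - Q.acceptProb x = ∑ j, ev (r j) x ^ 2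

-- `QueryAcceptPseudoBounded` holds: proved by `Summit.QuantumAdvantage.QuantumAdvantage.Theorems.SosSandwich.QueryAcceptPseudoBounded_proof` @ aeb987cab578 (its module imports this route file, so no `_holds` link can be stated here).

-- earlier PseudoBoundedRestrict (stmt-QuantumAdvantage-15075, replaced 2026-08-16T14:08:36Z -> stmt-QuantumAdvantage-15243): retired by None — ∀ (N T : ℕ) (p : MvPolynomial (Fin N) ℝ) (i : Fin N) (b : Bool), (∃ (m : ℕ) (q r : Fin m → MvPolynomial (Fin N) ℝ), (∀ j, (q j).totalDegree ≤ T ∧ (r j).totalDegree ≤ T) ∧ ∀ x : Fin N → Bool, Literature.Computability.QuantumComplexity.evalBool p x = ∑ j, Liter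
/-- item stmt-QuantumAdvantage-15243 · support · rank 9 · closed · proved by Summit.QuantumAdvantage.QuantumAdvantage.Theorems.SosSandwich.PseudoBoundedRestrict_proof @ 21b6dacf0b22 (prover) · by planner
sources: arXiv:0911.0996, arXiv:1411.7280
[support] K_T is closed under restriction: substituting a Boolean constant for one variable
(MvPolynomial.bind₁, the variable kept as a dummy) preserves pseudo-boundedness of order T
(substitute into the qⱼ, rⱼ; degrees do not increase). This is the only closure property the greedy
of TransferPB uses. [difficulty: provable-now] Cone repair rev 1: evaluation inline (defeq to the
rev-0 stmt-QuantumAdvantage-15075 by Iff.rfl, Equiv.lean). -/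
@[route_item "route-QuantumAdvantage-SosSandwich"]
def PseudoBoundedRestrict : Prop :=
  ∀ (N T : ℕ) (p : MvPolynomial (Fin N) ℝ) (i : Fin N) (b : Bool), let ev : MvPolynomial (Fin N) ℝ → (Fin N → Bool) → ℝ := fun f x => MvPolynomial.eval (fun k => if x k then (1 : ℝ) else 0) f; (∃ (m : ℕ) (q r : Fin m → MvPolynomial (Fin N) ℝ), (∀ j, (q j).totalDegree ≤ T ∧ (r j).totalDegree ≤ T) ∧ ∀ x : Fin N → Bool, ev p x = ∑ j, ev (q j) x ^ 2 ∧ 1 - ev p x = ∑ j, ev (r j) x ^ 2) → (∃ (m : ℕ) (q r : Fin m → MvPolynomial (Fin N) ℝ), (∀ j, (q j).totalDegree ≤ T ∧ (r j).totalDegree ≤ T) ∧ ∀ x : Fin N → Bool, ev (MvPolynomial.bind₁ (fun j => if j = i then MvPolynomial.C (if b then (1 : ℝ) else 0) else MvPolynomial.X j) p) x = ∑ j, ev (q j) x ^ 2 ∧ 1 - ev (MvPolynomial.bind₁ (fun j => if j = i then MvPolynomial.C (if b then (1 : ℝ) else 0) else MvPolynomial.X j) p) x = ∑ j, ev (r j)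 x ^ 2)

-- `PseudoBoundedRestrict` holds: proved by `Summit.QuantumAdvantage.QuantumAdvantage.Theorems.SosSandwich.PseudoBoundedRestrict_proof` @ 21b6dacf0b22 (its module imports this route file, so no `_holds` link can be stated here).

-- earlier PseudoBoundedDual (stmt-QuantumAdvantage-15076, replaced 2026-08-16T14:08:36Z -> stmt-QuantumAdvantage-15244): retired by None — ∀ (N T : ℕ) (p : MvPolynomial (Fin N) ℝ), (∃ (m : ℕ) (q r : Fin m → MvPolynomial (Fin N) ℝ), (∀ j, (q j).totalDegree ≤ T ∧ (r j).totalDegree ≤ T) ∧ ∀ x : Fin N → Bool, Literature.Computability.QuantumComplexity.evalBool p x = ∑ j, Literature.Computability.Quantum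
/-- item stmt-QuantumAdvantage-15244 · support · rank 9 · closed · proved by Summit.QuantumAdvantage.QuantumAdvantage.Theorems.SosSandwich.PseudoBoundedDual_proof @ ef697e0a0b90 (prover) · by planner
sources: doi:10.1007/978-0-387-09686-5_7, arXiv:1604.03084, arXiv:1411.7280
[support] conic duality on the finite cube (card K3's tool, stated as a theorem): p is
pseudo-bounded of order T iff every linear functional Ẽ on real functions of the cube with Ẽ[1] = 1
and Ẽ[q²] ≥ 0 for all q of total degree ≤ T satisfies 0 ≤ Ẽ[p] ≤ 1 (closedness of the
finite-dimensional SOS cone + bipolar theorem; the zero-mass case is removed by mixing with the true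
expectation). Gives refuters of K1 a finite certificate: one biased pseudo-density. [difficulty: M]
Cone repair rev 1: evaluation inline; `E (ev p)` = E (evalBool p) (defeq to the rev-0
stmt-QuantumAdvantage-15076 by Iff.rfl, Equiv.lean). -/
@[route_item "route-QuantumAdvantage-SosSandwich"]
def PseudoBoundedDual : Prop :=
  ∀ (N T : ℕ) (p : MvPolynomial (Fin N) ℝ), let ev : MvPolynomial (Fin N) ℝ → (Fin N → Bool) → ℝ := fun f x => MvPolynomial.eval (fun k => if x k then (1 : ℝ) else 0) f; (∃ (m : ℕ) (q r : Fin m → MvPolynomial (Fin N) ℝ), (∀ j, (q j).totalDegree ≤ T ∧ (r j).totalDegree ≤ T) ∧ ∀ x : Fin N → Bool, ev p x = ∑ j, ev (q j) x ^ 2 ∧ 1 - ev p x = ∑ j, ev (r j) x ^ 2) ↔ ∀ E : ((Fin N → Bool) → ℝ) →ₗ[ℝ] ℝ, E (fun _ => 1) = 1 → (∀ q : MvPolynomial (Fin N) ℝ, q.totalDegree ≤ T → 0 ≤ E (fun x => ev q x ^ 2)) → 0 ≤ E (ev p) ∧ E (ev p) ≤ 1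

-- `PseudoBoundedDual` holds: proved by `Summit.QuantumAdvantage.QuantumAdvantage.Theorems.SosSandwich.PseudoBoundedDual_proof` @ ef697e0a0b90 (its module imports this route file, so no `_holds` link can be stated here).

-- earlier AAConjImpliesPBAA (stmt-QuantumAdvantage-15077, replaced 2026-08-16T14:08:36Z -> stmt-QuantumAdvantage-15245): retired by None — (∃ (c : ℕ) (C : ℝ), 0 < C ∧ ∀ (N d : ℕ) (p : MvPolynomial (Fin N) ℝ) (ε : ℝ), 1 ≤ d → p.totalDegree ≤ d → (∀ x, 0 ≤ Literature.Computability.QuantumComplexity.evalBool p x ∧ Literature.Computability.QuantumComplexity.evalBool p x ≤ 1) → 0 < ε → ε ≤ Literature.Com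
/-- item stmt-QuantumAdvantage-15245 · support · rank 9 · closed · proved by Summit.QuantumAdvantage.QuantumAdvantage.Theorems.SosSandwich.AAConjImpliesPBAA_proof @ 21b6dacf0b22 (prover) · by planner
sources: arXiv:0911.0996, doi:10.1017/CBO9781139814782
[support] calibration: the Aaronson–Ambainis conjecture (the verbatim body of
RandomOracleGauge.AAConj = Literature AAConjecture, Iff.rfl checked in Sketch.lean) implies PB-AA —
a pseudo-bounded p of order T has a multilinear representative of total degree ≤ 2T with values in
[0,1], the same variance and influences, so AA at d = 2T gives C(ε/2T)^c. Places PB-AA strictly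
below the bridge hypothesis of RandomOracleGauge and below WT ∧ FHKLTotalL1 of SpikesNeedAddresses.
[difficulty: provable-now] Cone repair rev 1: the antecedent is the Aaronson–Ambainis conjecture
written with INLINE cube averages — Iff.rfl with
`Literature.Computability.QuantumComplexity.AAConjecture` and with SpikesNeedAddresses' inline AA
form (conclusion of WTGivesAA, antecedent of PromiseTransfer stmt-11702), both checked in Equiv.lean
— so AAConjecture stays out of the module cone while WT ∧ FHKLTotalL1 ⟹ AA ⟹ PB-AA chains
syntactically up to ζ/β. -/
@[route_item "route-QuantumAdvantage-SosSandwich"]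
def AAConjImpliesPBAA : Prop :=
  (∃ (c : ℕ) (C : ℝ), 0 < C ∧ ∀ (N d : ℕ) (p : MvPolynomial (Fin N) ℝ) (ε : ℝ), let ev : MvPolynomial (Fin N) ℝ → (Fin N → Bool) → ℝ := fun f x => MvPolynomial.eval (fun k => if x k then (1 : ℝ) else 0) f; let avg : ((Fin N → Bool) → ℝ) → ℝ := fun g => (∑ x : Fin N → Bool, g x) / (2 : ℝ) ^ N; 1 ≤ d → p.totalDegree ≤ d → (∀ x, 0 ≤ ev p x ∧ ev p x ≤ 1) → 0 < ε → ε ≤ (avg fun x => (ev p x - avg (ev p)) ^ 2) → ∃ i : Fin N, C * (ε / d) ^ c ≤ (avg fun x => (ev p x - ev p (Function.update x i (!x i))) ^ 2)) → PseudoBoundedAA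

-- `AAConjImpliesPBAA` holds: proved by `Summit.QuantumAdvantage.QuantumAdvantage.Theorems.SosSandwich.AAConjImpliesPBAA_proof` @ 21b6dacf0b22 (its module imports this route file, so no `_holds` link can be stated here).

/-- item stmt-QuantumAdvantage-27399 · support · rank 9 · open · by operator
sources: arXiv:2304.06713, arXiv:0911.0996
[support] HOMOGENEOUS SPECIAL CASE OF PB-AA, T-LOSSY (repair of HomogeneousPBAA
stmt-QuantumAdvantage-15241, refuted 2026-08-31 by Theorems.SosSandwich.not_HomogeneousPBAA: the
self-composed address family p = (1 + G(x)G(x'))/2 is pseudo-bounded of order T = 2^k,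
top-homogeneous, Var = 1/4 and EVERY influence = 1/T, so no degree-free constant exists). Statement
(= PseudoBoundedAA restricted to top-homogeneous inputs with ε := Var; critic PB26 form VT): there
are absolute c : ℕ and C > 0 such that every p pseudo-bounded of order T ≥ 1 (p = Σ qⱼ², 1 − p = Σ
rⱼ² on the cube, deg ≤ T) whose centred part lies on Fourier level exactly 2T (Laplacian
eigen-equation Σᵢ(p − p∘flipᵢ) = 4T(p − E p)) with Var[p] > 0 has a variable with Infᵢ[p] ≥
C·(Var[p]/T)^c. Lattice (kernel, writer RestateCheck.lean + critic chk/SosRestate.lean): refuted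
rev-1 (c-free Var²) ⇒ V2 := «Inf ≥ C·Var²/T^c» ⇒ VT ⇐ PseudoBoundedAA (ε := Var); VT is implied by
the crux, so it can only be refuted together with the crux (15241 died alone precisely because it
was not). Calibration: on the address family 4·Var/T = Infᵢ and 16·Var²/T = Infᵢ WITH EQUALITY ⇒ c ≥
1 forced, c = 1 tight; Escudero Gutiérrez arXiv:2304.06713 Thm -/
@[route_item "route-QuantumAdvantage-SosSandwich", crux]
def HomogeneousPBAAT : Prop :=
  ∃ (c : ℕ) (C : ℝ), 0 < C ∧ ∀ (N T : ℕ) (p : MvPolynomial (Fin N) ℝ), let ev : MvPolynomial (Fin N) ℝ → (Fin N → Bool) → ℝ := fun f x => MvPolynomial.eval (fun k => if x k then (1 : ℝ) else 0) f; let avg : ((Fin N → Bool) → ℝ) → ℝ := fun g => (∑ x : Fin N → Bool, g x) / (2 : ℝ) ^ N; 1 ≤ T → (∃ (m : ℕ) (q r : Fin m → MvPolynomial (Fin N) ℝ), (∀ j, (q j).totalDegree ≤ T ∧ (r j).totalDegree ≤ T) ∧ ∀ x : Fin N → Bool, ev p x = ∑ j, ev (q j) x ^ 2 ∧ 1 -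 ev p x = ∑ j, ev (r j) x ^ 2) → (∀ x : Fin N → Bool, ∑ i : Fin N, (ev p x - ev p (Function.update x i (!x i))) = 4 * (T : ℝ) * (ev p x - avg (ev p))) → 0 < (avg fun x => (ev p x - avg (ev p)) ^ 2) → ∃ i : Fin N, C * ((avg fun x => (ev p x - avg (ev p)) ^ 2) / (T : ℝ)) ^ c ≤ (avg fun x => (ev p x - ev p (Function.update x i (!x i))) ^ 2)

/-- item stmt-QuantumAdvantage-27571 · support · rank 9 · closed · proved by Summit.QuantumAdvantage.QuantumAdvantage.Theorems.SosSandwich.CornerLift.varianceSaturation_served (prover) · by planner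
[aside] U = VARIANCE SATURATION INSIDE K (cell decomp-qadv, lens-5 g19 NODE «CornerDial» on
SosSandwich:PseudoBoundedAA stmt-QuantumAdvantage-15237; critic 74v9 VERIFIED + ROUTE ADVICE «file U
as support item of 15237, record R as the corner normal form, no child route needed»; lens-5 g20
CONFIRMED the coin-free repair 2026-08-31T02:31Z). STATEMENT (Iff.rfl to lens-5
`Theses.CornerDial.VarianceSaturation`, re-spelled in this route's cone-safe INLINE vocabulary
exactly like PseudoBoundedAA rev 1 — `let ev / let avg`, inline SOS form of `PseudoBounded T p`;
keeps AaronsonAmbainis.lean / PseudoBounded.lean out of the module cone; writer sketch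
rt-cd/CornerSketch.lean rc0): for every η > 0 there are a, A > 0 such that every pseudo-bounded p of
order T ≥ 1 with Var[p] ≥ ε > 0 has an image P, pseudo-bounded of order T' with 1 ≤ T' ≤ A(T/ε)^a,
variance in the TOP BAND Var[P] ≥ 1/4 − η, and EVERY influence of P at most A(T/ε)^a times SOME
influence of p (comparison-clause shape of Cruxes/AAConj/SplitAssembly.lean). WHY ASIDE: the
deciding theorem of this route does not consume U (bc6: a support binder outside the cone of
`closes` is unaccounted); U is NECESSARY for 15237 (kernel: PB-AA ⟹ U -/
@[route_item "route-QuantumAdvantage-SosSandwich"]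
def VarianceSaturation : Prop :=
  ∀ η : ℝ, 0 < η → ∃ (a : ℕ) (A : ℝ), 0 < A ∧ ∀ (N T : ℕ) (p : MvPolynomial (Fin N) ℝ) (ε : ℝ), let ev : MvPolynomial (Fin N) ℝ → (Fin N → Bool) → ℝ := fun f x => MvPolynomial.eval (fun k => if x k then (1 : ℝ) else 0) f; let avg : ((Fin N → Bool) → ℝ) → ℝ := fun g => (∑ x : Fin N → Bool, g x) / (2 : ℝ) ^ N; 1 ≤ T → (∃ (m : ℕ) (q r : Fin m → MvPolynomial (Fin N) ℝ), (∀ j, (q j).totalDegree ≤ T ∧ (r j).totalDegree ≤ T) ∧ ∀ x : Fin N → Bool, ev p x = ∑ j, ev (q j) x ^ 2 ∧ 1 - ev p x = ∑ j, ev (r j) x ^ 2) → 0 < ε → ε ≤ (avg fun x => (ev p x - avg (ev p)) ^ 2) → ∃ (N' T' : ℕ) (P : MvPolynomial (Fin N') ℝ), let ev' : MvPolynomial (Fin N') ℝ → (Fin N' → Bool) → ℝ := fun f x => MvPolynomial.eval (fun k => if x k then (1 : ℝ) else 0) f; let avg' : ((Fin N' → Bool) → ℝ) → ℝ := fun g =>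 (∑ x : Fin N' → Bool, g x) / (2 : ℝ) ^ N'; 1 ≤ T' ∧ (T' : ℝ) ≤ A * ((T : ℝ) / ε) ^ a ∧ (∃ (m : ℕ) (q r : Fin m → MvPolynomial (Fin N') ℝ), (∀ j, (q j).totalDegree ≤ T' ∧ (r j).totalDegree ≤ T') ∧ ∀ x : Fin N' → Bool, ev' P x = ∑ j, ev' (q j) x ^ 2 ∧ 1 - ev' P x = ∑ j, ev' (r j) x ^ 2) ∧ 1 / 4 - η ≤ (avg' fun x => (ev' P x - avg' (ev' P)) ^ 2) ∧ ∀ j : Fin N', ∃ i : Fin N, (avg' fun x => (ev' P x - ev' P (Function.update x j (!x j))) ^ 2) ≤ A * ((T : ℝ) / ε) ^ a * (avg fun x => (ev p x - ev p (Function.update x i (!x i))) ^ 2)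

/-- `VarianceSaturation` holds: proved by `Summit.QuantumAdvantage.QuantumAdvantage.Theorems.SosSandwich.CornerLift.varianceSaturation_served`. -/
theorem VarianceSaturation_holds : VarianceSaturation := _root_.Summit.QuantumAdvantage.QuantumAdvantage.Theorems.SosSandwich.CornerLift.varianceSaturation_served

/-- item stmt-QuantumAdvantage-15078 · assembly · rank 1 · closed · proved by Summit.QuantumAdvantage.QuantumAdvantage.Theorems.SosSandwich.Assembly_proof @ 14e6512b64f3 (prover) · by planner
sources: arXiv:0911.0996, Literature.Barriers.QuantumAdvantage.RandomOracleMethod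
[assembly] PseudoBoundedAA → TransferPB → RandomOracleHeurSeparation → PromiseLanguageLift →
QuantumAdvantage. -/
@[route_item "route-QuantumAdvantage-SosSandwich"]
def Assembly : Prop :=
  PseudoBoundedAA → TransferPB → RandomOracleHeurSeparation → PromiseLanguageLift → _root_.QuantumAdvantage

-- `Assembly` holds: proved by `Summit.QuantumAdvantage.QuantumAdvantage.Theorems.SosSandwich.Assembly_proof` @ 14e6512b64f3 (its module imports this route file, so no `_holds` link can be stated here).

-- records of items no longer active in this route (dropped / restated):
-- earlier HomogeneousPBAA (stmt-QuantumAdvantage-15073, replaced 2026-08-16T14:08:36Z -> stmt-QuantumAdvantage-15241): retired by None — ∃ C : ℝ, 0 < C ∧ ∀ (N T : ℕ) (p : MvPolynomial (Fin N) ℝ), 1 ≤ T → (∃ (m : ℕ) (q r : Fin m → MvPolynomial (Fin N) ℝ), (∀ j, (q j).totalDegree ≤ T ∧ (r j).totalDegree ≤ T) ∧ ∀ x : Fin N → Bool, Literature.Computability.QuantumComplexity.evalBool p x = ∑ j, Literatur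
-- earlier HomogeneousPBAA (stmt-QuantumAdvantage-15241, replaced 2026-08-31T14:05:20Z -> stmt-QuantumAdvantage-27399): refuted by Summit.QuantumAdvantage.QuantumAdvantage.Theorems.SosSandwich.not_HomogeneousPBAA — ∃ C : ℝ, 0 < C ∧ ∀ (N T : ℕ) (p : MvPolynomial (Fin N) ℝ), let ev : MvPolynomial (Fin N) ℝ → (Fin N → Bool) → ℝ := fun f x => MvPolynomial.eval (fun k => if x k then (1 : ℝ) else 0) f; let

/-! D-0027 §2.1 — DECIDING THEOREM (planner-authored via `route open/edit --closes-file`; by planner-rrepair-QuantumAdvantage-SosSandwich-936371f0-0 2026-08-16T14:08:36Z):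
its hypotheses are this route's items and its conclusion the sub-problem Statement (glue_lint), and it elaborates with this file. -/

/-- D-0027 §2.1 deciding theorem of route SosSandwich (rev 1, cone repair: the vocabulary-bearing items are
restated over fact-free modules — `randomOracle` (RandomOracleMeasure.lean), `Complexity.AvgPRel` (AvgPRel.lean) —
and inline cube averages, each definitionally equal to its rev-0 form; the logic is unchanged): were the summit
false, `BQP ⊆ BPP`; PromiseLanguageLift lifts it to `PromiseBQP ⊆ PromiseBPP'`; TransferPB, granted the
pseudo-bounded Aaronson–Ambainis statement PseudoBoundedAA, transfers that to the almost-sure random-oracle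
collapse `∀ᵐ A ∂randomOracle, BQP^A ⊆ AvgP^A`, which RandomOracleHeurSeparation denies. -/
@[closes "route-QuantumAdvantage-SosSandwich"] theorem closes (hK : PseudoBoundedAA) (hT : TransferPB) (hX : RandomOracleHeurSeparation)
    (hPL : PromiseLanguageLift) : _root_.QuantumAdvantage := by
  by_contra hS
  refine hX (hT hK (hPL ?_))
  intro L hL
  by_contra hL'
  exact hS ⟨L, hL, hL'⟩

end Summit.QuantumAdvantage.QuantumAdvantage.Theses.SosSandwich
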